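import Mathlib
import Literature.MathematicalPhysics.QuantumLattice.EuclideanAction

/-!
# Sketch — first lemmas of the crux-idea cards for `PencilRigidity.CurvatureKernelBound`
(stmt-QuantumFields-11687), planner-cruxidea-…-2-0, round 1.

* `AxisDomination`      — card `axis-extremal-collapse` (lever A): 2×2 minors of the pointwise
  OS-positive form across `x₀ = 0` plus signed-permutation invariance put the whole off-origin
  size of a kernel on the time axis: `|K x| ≤ K(|x_μ| e₀)` for every non-zero coordinate, and
  `t ↦ K(t e₀)` is non-negative and mid-point log-convex.
* `ConeTauberian`       — card `mirror-cone-smeared-doubling` (lever B): a positive measure on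
  `ℝ × ℝ³` carried by the Euclidean spectral cone `{E ≥ ‖p‖}` and polynomially bounded on boxes
  has a FINITE axial Laplace function `M(t) = ∫ e^{-tE} dμ` of polynomial order in `t⁻¹`.
Both are stated over Mathlib + the tree's `timeReflection`; proofs are not part of this mode.
-/

open MeasureTheory
open Literature.MathematicalPhysics.QuantumLattice

namespace Summit.QuantumFields.YangMills.Cruxes.CurvatureKernelBound.Sketch

/-- **Lever A, first lemma (kernel level, elementary).** For a real kernel on `ℝ⁴` invariant
under all signed permutations and pointwise OS-positive across the mirror `x₀ = 0` (exactly the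
positivity clause of `PencilRigidity.ShellRigidity` / conclusion (ii) of `KernelTransfer`):
(i) `K(t e₀) ≥ 0` for `t > 0`; (ii) `K((s+t) e₀)² ≤ K(2s e₀) K(2t e₀)` (mid-point log-convexity
on the axis); (iii) AXIS DOMINATION `|K x| ≤ K(|x μ| • e₀)` whenever `x μ ≠ 0` — hence
`|K x| ≤ min_μ K(|x_μ| e₀)`: the time axis is extremal. Proof: the `m = 1, 2` instances of the
positivity clause are `1×1` and `2×2` positive semi-definite matrices; symmetry of the `2×2`
matrix and the transport `e_μ ↦ e₀` are signed permutations. -/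
def AxisDomination : Prop :=
  let E := EuclideanSpace ℝ (Fin 4)
  ∀ (K : E → ℝ),
    (∀ R : E ≃ₗᵢ[ℝ] E,
        (∀ i : Fin 4, ∃ j : Fin 4, R (EuclideanSpace.single i 1) = EuclideanSpace.single j 1 ∨
          R (EuclideanSpace.single i 1) = -EuclideanSpace.single j 1) →
        ∀ x : E, K (R x) = K x) →
    (∀ (m : ℕ) (x : Fin m → E) (c : Fin m → ℝ), (∀ i, 0 < x i 0) →
        0 ≤ ∑ i, ∑ j, c i * c j * K (timeReflection 4 (x i) - x j)) →
    (∀ t : ℝ, 0 < t → 0 ≤ K (EuclideanSpace.single 0 t)) ∧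
    (∀ s t : ℝ, 0 < s → 0 < t →
        K (EuclideanSpace.single 0 (s + t)) ^ 2 ≤
          K (EuclideanSpace.single 0 (2 * s)) * K (EuclideanSpace.single 0 (2 * t))) ∧
    (∀ (x : E) (μ : Fin 4), x μ ≠ 0 → |K x| ≤ K (EuclideanSpace.single 0 |x μ|))

/-- **Lever B, first lemma (measure level, layer-cake).** A positive Borel measure `μ` on
`ℝ × ℝ³` (energy `E = q.1`, spatial momentum `p = q.2`) which is carried by a Euclidean
spectral cone `{‖p‖ ≤ κ E}` (`κ = √3` is what the three planar cones `E ≥ |p_j|` of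
`MirrorModularBoosts.PlanarSpectralCone` give: `‖p‖₂ ≤ √3 ‖p‖_∞ ≤ √3 E`) and is polynomially
bounded on the boxes `{E ≤ Λ, ‖p‖ ≤ Λ}` (temperedness of the OS Laplace measure) has, for every
`t > 0`, an integrable axial Laplace density with
`M(t) = ∫ e^{-tE} dμ ≤ C · κ^N · 2^N · N! · (1 + t⁻¹)^N`: the axial function of lever A is FINITE
and of polynomial order for free once the cone is available. Proof: `{E ≤ Λ} ⊆ {E ≤ κΛ, ‖p‖ ≤ κΛ}`
`μ`-a.e. for `Λ ≥ 0` (and `{E < 0}` is `μ`-null), then `∫ e^{-tE} dμ = ∫₀^∞ t e^{-tΛ} μ{E ≤ Λ} dΛ`. -/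
def ConeTauberian : Prop :=
  ∀ (μ : Measure (ℝ × EuclideanSpace ℝ (Fin 3))) (κ C : ℝ) (N : ℕ), 1 ≤ κ →
    μ {q | κ * q.1 < ‖q.2‖} = 0 →
    (∀ Λ : ℝ, μ {q | q.1 ≤ Λ ∧ ‖q.2‖ ≤ Λ} ≠ ⊤) →
    (∀ Λ : ℝ, 0 ≤ Λ → (μ {q | q.1 ≤ Λ ∧ ‖q.2‖ ≤ Λ}).toReal ≤ C * (1 + Λ) ^ N) →
    ∀ t : ℝ, 0 < t →
      Integrable (fun q : ℝ × EuclideanSpace ℝ (Fin 3) => Real.exp (-(t * q.1))) μ ∧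
      ∫ q, Real.exp (-(t * q.1)) ∂μ ≤ C * κ ^ N * 2 ^ N * (N.factorial : ℝ) * (1 + t⁻¹) ^ N

end Summit.QuantumFields.YangMills.Cruxes.CurvatureKernelBound.Sketch
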